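import Summits.AtomisticToContinuum.HydrodynamicLimit.Theorems.OneFlightGossipEngineKineticCurrentsLDAlongFamiliesKCWUSharpPlus
import Summits.AtomisticToContinuum.HydrodynamicLimit.Theorems.ImplosionDichotomyHydroLimitInBandSignedBandDefs
import HarnessLib

/-!
# KCWF-Q from the pointwise rung `KCWUSharpPlus` — the kinetic input of line `IdeatorOneSketch`
# (crux `HydroLimitProfilewiseBand`, stmt-AtomisticToContinuum-17372) reduced to crux 16659's single registered stub

Route `ImplosionDichotomy`, sub-problem `HydrodynamicLimit`; lead prover-line-stmt-AtomisticToContinuum-17372-c8-0 (line cycle 9).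

The two open stubs of the registered skeleton v12 of this crux (shared verbatim with stmt-9133's v16) are `stub_items4`
(four items) and `stub_kcwfQ : HydroLimitInBandSignedBand.KineticCurrentsLDAlongFamiliesQ` — KCWF-Q, the kinetic-currents
window LD along families with a CLASS-UNIFORM tilt threshold (`∃ β₀` before the weights, normalisation `|β|·C ≤ β₀`), filed
meanwhile as the route item `OneFlightGossipEngine.KineticCurrentsLDAlongFamiliesQ` (stmt-18052, byte-identical). This file proves
that KCWF-Q is NOT a new kinetic obligation: it follows from the single registered stub `KCWUSharpPlus` of crux 16659's line
`Sketch` (the POINTWISE docking rung with a NUMERIC tilt threshold `β₀(Θ,U,C,Λ,σ)` for the class enlarged by its radial sector),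
by the landed net-transfer argument of that line (`KineticCurrentsLDAlongFamiliesSketch.stub_transferByNetsEv`, p137211: finite
net in the family parameter, static change of reference law S5, joint modulus S6, window tails S9/S10/S8) run at growth
constant `1` after the scaling `F ↦ F/C`, `β ↦ βC`: the class `A(x):w⊗w + (b(x)·w)G(x,|w|²)` and its three orthogonality rows are
invariant under scaling, the window functional is linear, and every constant the net produces then depends on the profile family,
`σ` and the flow family only — which is exactly the position of `∃ β₀` in KCWF-Q.

* `kcwfQ_transferByNetsEv` — KCWF-Q from the four neighbour shapes of `stub_transferByNetsEv` (hypotheses byte-identical with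
  that theorem's: the KCWUSharp rung hK, the family window tails hT, the change of law hR, the bounds/modulus hB).
* `kcwfQ_of_kcwuSharpPlus` — KCWF-Q from `KCWUSharpPlus` ALONE (hypothesis byte-identical with the registered stub
  `stub_kcwuSharpPlus` of `Cruxes/KineticCurrentsLDAlongFamilies/Lines/Sketch.lean` and with the hypothesis of the landed
  `stub_kcwuSharpPlus_implies_crux`, p137412), the other three shapes being landed (p137070 ∘ p136745 ∘ p136419, p129139, p128108).
* `kcwfQ_iff_routeItem` — the route item stmt-18052 and the Theorems def are the same proposition (`Iff.rfl`), hence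
  stmt-18052 ⟸ `KCWUSharpPlus` as well (`HydroLimitProfilewiseBandKcwfQGlue.routeKcwfQ_of_kcwuSharpPlus`, companion file);
  `kcwf_of_routeKcwfQ` — the item 16659 is a corollary of the item 18052 (the landed `kcwf_of_kcwfQ`).

Consequence for the lines: 17372 (this crux), 9133, 16659 and 18052 hinge on ONE kinetic statement, `KCWUSharpPlus`
(conjecture-grade: kinetic relaxation of non-hydrodynamic one-body modes at LD scale over `τ ≫ 1` mean free times for
deterministic hard spheres at fixed reduced density; not claimed here).

References: S. Olla, S. R. S. Varadhan, H.-T. Yau, Comm. Math. Phys. 155 (1993) §2; H. Spohn, *Large Scale Dynamics of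
Interacting Particles* (1991), Part I §2.3.
-/

noncomputable section

open MeasureTheory Set Filter
open scoped ENNReal Topology

namespace Summit.AtomisticToContinuum.HydrodynamicLimit.Theorems.HydroLimitProfilewiseBandKcwfQ

open Literature.Analysis.FluidPDE (HardSphereFlow Config localMaxwellian canonicalDensity liouville)
open Literature.MathematicalPhysics.KineticTheory (T3 V3 hsDiameter localGibbsLaw localGibbsMeasure
  localGibbsProfile)
open Literature.Analysis.FluidPDE Literature.MathematicalPhysics.KineticTheory
open Summit.AtomisticToContinuum.HydrodynamicLimit.Theses.OneFlightGossipEngine (KineticCurrentsLDAlongFamilies)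
open Summit.AtomisticToContinuum.HydrodynamicLimit.Theorems.KineticCurrentsLDAlongFamiliesSketch
open Summit.AtomisticToContinuum.HydrodynamicLimit.Theorems.HydroLimitInBandSignedBand (kcwf_of_kcwfQ)

/-- **Scaling of the class representation.** `c · (A(x):w⊗w + (b(x)·w) G(x,‖w‖²)) = (cA)(x):w⊗w + ((c b)(x)·w) G(x,‖w‖²)`:
the class of kinetic-current weights is a cone. [folklore] -/
theorem class_rep_smul (A : T3 → Fin 3 → Fin 3 → ℝ) (b : T3 → V3) (G : T3 × ℝ → ℝ) (u₀ : T3 → V3)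
    (c : ℝ) (y : T3 × V3) :
    c * ((∑ j : Fin 3, ∑ k : Fin 3, A y.1 j k * ((y.2 - u₀ y.1) j * (y.2 - u₀ y.1) k)) +
        (∑ j : Fin 3, b y.1 j * (y.2 - u₀ y.1) j) * G (y.1, ‖y.2 - u₀ y.1‖ ^ 2)) =
      (∑ j : Fin 3, ∑ k : Fin 3, (c * A y.1 j k) * ((y.2 - u₀ y.1) j * (y.2 - u₀ y.1) k)) +
        (∑ j : Fin 3, (c • b y.1) j * (y.2 - u₀ y.1) j) * G (y.1, ‖y.2 - u₀ y.1‖ ^ 2) := by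
  simp only [PiLp.smul_apply, smul_eq_mul, mul_add, Finset.mul_sum, Finset.sum_mul]
  congr 1
  · exact Finset.sum_congr rfl fun j _ => Finset.sum_congr rfl fun k _ => by ring
  · exact Finset.sum_congr rfl fun j _ => by ring

/-- **KCWF-Q from the four neighbour shapes of the net transfer** (hypotheses byte-identical with those of the landed
`KineticCurrentsLDAlongFamiliesSketch.stub_transferByNetsEv`, p137211): (hK) the pointwise rung with a NUMERIC tilt threshold
`β₀(Θ,U,C,Λ,σ)` for the structured class, (hT) the family window tails under the packing guard, eventually in `τ`, (hR) the
static change of reference law, (hB) the family bounds and one joint modulus of the class functional. Proof: the net transfer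
of p137211 run for the SCALED functional `F' = F/C` (growth constant `1`, same class with weights `A/C, b/C, G`, same three
orthogonality rows) at the tilt `βC` (`|βC| ≤ β₀`), with `β₀ := min(β₁(Θ,U,1,Λ,σ)/4, γ₀/48)` fixed BEFORE the weights from the
family bounds (hB at the zero weights), the rung and the tails; the window functional is linear, so the bound for `(βC, F')` is
the bound for `(β, F)`. `η₀ := min(η₁, η_T, 1/8)`. [folklore] -/
theorem kcwfQ_transferByNetsEv :
    (∃ η₀ : ℝ, 0 < η₀ ∧ ∀ (Θ U C Λ : ℝ), 1 ≤ Θ → 0 ≤ U → 0 ≤ C → 1 ≤ Λ → ∀ σ : ℝ, 0 < σ →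
        ∃ β₀ : ℝ, 0 < β₀ ∧
        ∀ (a θ₀ : T3 → ℝ) (u₀ : T3 → V3), Continuous a → Continuous θ₀ → Continuous u₀ →
        (∀ x, Λ⁻¹ ≤ a x ∧ a x ≤ Λ) → (∀ x, Θ⁻¹ ≤ θ₀ x ∧ θ₀ x ≤ Θ) → (∀ x, ‖u₀ x‖ ≤ U) →
        σ ^ 3 * (⨆ x, a x) ≤ η₀ * ∫ x, a x →
        ∀ Φ : (N : ℕ) →
          HardSphereFlow (Torus.geometry (Fin 3)) (hsDiameter σ N) (N + 1),
        ∀ (A : T3 → Fin 3 → Fin 3 → ℝ) (b : T3 → V3) (G : T3 × ℝ → ℝ),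
        Continuous A → Continuous b → Continuous G →
        ∀ F : T3 × V3 → ℝ, (∀ y, F y =
          (∑ j : Fin 3, ∑ k : Fin 3, A y.1 j k * ((y.2 - u₀ y.1) j * (y.2 - u₀ y.1) k)) +
            (∑ j : Fin 3, b y.1 j * (y.2 - u₀ y.1) j) * G (y.1, ‖y.2 - u₀ y.1‖ ^ 2)) →
        (∀ y, |F y| ≤ C * (1 + ‖y.2‖ ^ 2)) →
        (∀ x, ∫ v, F (x, v) * localMaxwellian 1 (θ₀ x) (u₀ x) v = 0) →
        (∀ x (j : Fin 3), ∫ v, F (x, v) * v j * localMaxwellian 1 (θ₀ x) (u₀ x) v = 0) →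
        (∀ x, ∫ v, F (x, v) * ‖v‖ ^ 2 * localMaxwellian 1 (θ₀ x) (u₀ x) v = 0) →
        ∀ β : ℝ, |β| ≤ β₀ → ∀ ε : ℝ, 0 < ε → ∃ τ₀ : ℝ, 0 < τ₀ ∧ ∀ τ : ℝ, τ₀ ≤ τ →
        ∃ N₀ : ℕ, ∀ N : ℕ, N₀ ≤ N →
          ∫⁻ z, ENNReal.ofReal (Real.exp (β * ∑ i : Fin (N + 1),
              (τ * ((N : ℝ) + 1) ^ (-(1 / 3 : ℝ)))⁻¹ *
                ∫ r in (0 : ℝ)..(τ * ((N : ℝ) + 1) ^ (-(1 / 3 : ℝ))), F (((Φ N).flow r z) i)))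
            ∂(localGibbsLaw σ a u₀ θ₀ N (Φ N)) ≤
          ENNReal.ofReal (Real.exp (ε * ((N : ℝ) + 1)))) →
    (∃ η : ℝ, 0 < η ∧ ∀ (t₁ : ℝ) (a θ₀ : ℝ → T3 → ℝ) (u₀ : ℝ → T3 → V3),
        Continuous (Function.uncurry a) → Continuous (Function.uncurry θ₀) →
        Continuous (Function.uncurry u₀) → (∀ s x, 0 < a s x) → (∀ s x, 0 < θ₀ s x) →
        ∀ σ : ℝ, 0 < σ → (∀ s ∈ Icc 0 t₁, σ ^ 3 * (⨆ x, a s x) ≤ η * ∫ x, a s x) →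
        ∀ Φ : (N : ℕ) → HardSphereFlow (Torus.geometry (Fin 3)) (hsDiameter σ N) (N + 1),
        ∃ γ₀ : ℝ, 0 < γ₀ ∧ ∀ γ : ℝ, 0 ≤ γ → γ ≤ γ₀ → ∀ κ : ℝ, 0 < κ → ∃ V : ℝ, 1 ≤ V ∧
        ∃ τ₀ : ℝ, 0 < τ₀ ∧ ∀ τ : ℝ, τ₀ ≤ τ → ∃ N₀ : ℕ, ∀ N : ℕ, N₀ ≤ N → ∀ s ∈ Icc 0 t₁,
          ∫⁻ z, ENNReal.ofReal (Real.exp (γ * ∑ i : Fin (N + 1),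
              (τ * ((N : ℝ) + 1) ^ (-(1 / 3 : ℝ)))⁻¹ *
                ∫ r in (0 : ℝ)..(τ * ((N : ℝ) + 1) ^ (-(1 / 3 : ℝ))),
                  max 0 (‖(((Φ N).flow r z) i).2‖ ^ 2 - V)))
            ∂(localGibbsLaw σ (a s) (u₀ s) (θ₀ s) N (Φ N)) ≤
          ENNReal.ofReal (Real.exp (κ * ((N : ℝ) + 1)))) →
    (∀ (t₁ : ℝ) (a θ₀ : ℝ → T3 → ℝ) (u₀ : ℝ → T3 → V3),
        Continuous (Function.uncurry a) → Continuous (Function.uncurry θ₀) →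
        Continuous (Function.uncurry u₀) → (∀ s x, 0 < a s x) → (∀ s x, 0 < θ₀ s x) →
        ∀ σ : ℝ, 0 < σ → σ ≤ 1 / 2 → ∀ κ : ℝ, 0 < κ → ∃ δ : ℝ, 0 < δ ∧
        ∀ Φ : (N : ℕ) → HardSphereFlow (Torus.geometry (Fin 3)) (hsDiameter σ N) (N + 1),
        ∀ N : ℕ, ∀ s ∈ Icc 0 t₁, ∀ s' ∈ Icc 0 t₁, |s - s'| ≤ δ →
        ∀ g : Config (N + 1) (Fin 3) T3 → ℝ≥0∞,
          AEMeasurable g (liouville (Torus.geometry (Fin 3)) (N + 1) (hsDiameter σ N)) →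
          ∫⁻ z, g z ∂(localGibbsLaw σ (a s') (u₀ s') (θ₀ s') N (Φ N)) ≤
            (∫⁻ z, g z ^ 2 ∂(localGibbsLaw σ (a s) (u₀ s) (θ₀ s) N (Φ N))) ^ (1 / 2 : ℝ) *
              ENNReal.ofReal (Real.exp (κ * ((N : ℝ) + 1)))) →
    (∀ (t₁ : ℝ) (a θ₀ : ℝ → T3 → ℝ) (u₀ : ℝ → T3 → V3),
        Continuous (Function.uncurry a) → Continuous (Function.uncurry θ₀) →
        Continuous (Function.uncurry u₀) → (∀ s x, 0 < a s x) → (∀ s x, 0 < θ₀ s x) →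
        ∀ (A : ℝ → T3 → Fin 3 → Fin 3 → ℝ) (b : ℝ → T3 → V3) (G : ℝ → T3 × ℝ → ℝ),
        Continuous (Function.uncurry A) → Continuous (Function.uncurry b) →
        Continuous (Function.uncurry G) →
        ∀ F : ℝ → T3 × V3 → ℝ, (∀ s y, F s y =
          (∑ j : Fin 3, ∑ k : Fin 3, A s y.1 j k * ((y.2 - u₀ s y.1) j * (y.2 - u₀ s y.1) k)) +
            (∑ j : Fin 3, b s y.1 j * (y.2 - u₀ s y.1) j) * G s (y.1, ‖y.2 - u₀ s y.1‖ ^ 2)) →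
        ∃ Θ U Λ : ℝ, 1 ≤ Θ ∧ 0 ≤ U ∧ 1 ≤ Λ ∧
          (∀ s ∈ Icc 0 t₁, ∀ x, Θ⁻¹ ≤ θ₀ s x ∧ θ₀ s x ≤ Θ) ∧
          (∀ s ∈ Icc 0 t₁, ∀ x, ‖u₀ s x‖ ≤ U) ∧
          (∀ s ∈ Icc 0 t₁, ∀ x, Λ⁻¹ ≤ a s x ∧ a s x ≤ Λ) ∧
          ∀ R : ℝ, ∀ ω : ℝ, 0 < ω → ∃ δ : ℝ, 0 < δ ∧
            ∀ s ∈ Icc 0 t₁, ∀ s' ∈ Icc 0 t₁, |s - s'| ≤ δ →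
            ∀ (x : T3) (v : V3), ‖v‖ ≤ R → |F s (x, v) - F s' (x, v)| ≤ ω) →
    HydroLimitInBandSignedBand.KineticCurrentsLDAlongFamiliesQ := by
  intro hK hT hR hB
  delta Summit.AtomisticToContinuum.HydrodynamicLimit.Theorems.HydroLimitInBandSignedBand.KineticCurrentsLDAlongFamiliesQ
  obtain ⟨η₁, hη₁, hK'⟩ := hK
  obtain ⟨ηT, hηT, hT'⟩ := hT
  refine ⟨min η₁ (min ηT (1 / 8)), lt_min hη₁ (lt_min hηT (by norm_num)), ?_⟩
  intro t₁ a θ₀ u₀ ha hθ hu ha0 hθ0 σ hσ hguard Φ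
  -- the degenerate parameter interval `t₁ < 0`: everything is vacuous
  by_cases ht : t₁ < 0
  · refine ⟨1, one_pos, ?_⟩
    intro A b G hA hb hG F C hC0 hCb h1 hv hE β hβ ε hε
    exact ⟨1, one_pos, fun τ _ => ⟨0, fun N _ s hs => absurd (hs.1.trans hs.2) (not_le.2 ht)⟩⟩
  replace ht : 0 ≤ t₁ := not_lt.1 ht
  have h0 : (0 : ℝ) ∈ Icc 0 t₁ := ⟨le_rfl, ht⟩
  -- Step 1: the guard gives `σ ≤ 1/2` (at `s = 0`), the S1-guard and the tails' guard at every `s`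
  have hint_le : ∀ s, ∫ x, a s x ≤ ⨆ x, a s x := fun s =>
    KineticCurrentsWindowLDUniformSketch.integral_le_iSup_T3 (ha.uncurry_left s)
  have hint_nn : ∀ s, 0 ≤ ∫ x, a s x := fun s => integral_nonneg fun x => (ha0 s x).le
  have hguard1 : ∀ s ∈ Icc 0 t₁, σ ^ 3 * (⨆ x, a s x) ≤ η₁ * ∫ x, a s x := fun s hs =>
    (hguard s hs).trans (mul_le_mul_of_nonneg_right (min_le_left _ _) (hint_nn s))
  have hguardT : ∀ s ∈ Icc 0 t₁, σ ^ 3 * (⨆ x, a s x) ≤ ηT * ∫ x, a s x := fun s hs =>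
    (hguard s hs).trans (mul_le_mul_of_nonneg_right
      ((min_le_right _ _).trans (min_le_left _ _)) (hint_nn s))
  have hσ2 : σ ≤ 1 / 2 := by
    have h8 : σ ^ 3 * (⨆ x, a 0 x) ≤ 1 / 8 * (⨆ x, a 0 x) :=
      (hguard 0 h0).trans ((mul_le_mul_of_nonneg_right
        ((min_le_right _ _).trans (min_le_right _ _)) (hint_nn 0)).trans
        (mul_le_mul_of_nonneg_left (hint_le 0) (by norm_num)))
    have hsup_pos : 0 < ⨆ x, a 0 x :=
      lt_of_lt_of_le (ha0 0 0) (le_ciSup (isCompact_range (ha.uncurry_left 0)).bddAbove 0)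
    have h8' : σ ^ 3 ≤ (1 / 2) ^ 3 := by nlinarith
    exact le_of_pow_le_pow_left₀ (by norm_num) (by norm_num) h8'
  -- Step 2: the constants fixed BEFORE the weights — the family bounds (S6 at the zero weights), `β₁` (S1 at growth `1`),
  -- `γ₀` (tails); the class-uniform threshold is `β₀ := min (β₁/4) (γ₀/48)`
  obtain ⟨Θ, U, Λ, hΘ1, hU0, hΛ1, hΘb, hUb, hΛb, -⟩ :=
    hB t₁ a θ₀ u₀ ha hθ hu ha0 hθ0 (fun _ _ _ _ => 0) (fun _ _ => 0) (fun _ _ => 0)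
      continuous_const continuous_const continuous_const _ (fun s y => rfl)
  obtain ⟨β₁, hβ₁, hK1⟩ := hK' Θ U 1 Λ hΘ1 hU0 zero_le_one hΛ1 σ hσ
  obtain ⟨γ₀, hγ₀, hT1⟩ := hT' t₁ a θ₀ u₀ ha hθ hu ha0 hθ0 σ hσ hguardT Φ
  refine ⟨min (β₁ / 4) (γ₀ / 48), lt_min (by positivity) (by positivity), ?_⟩
  intro A b G hA hb hG F C hC0 hCb h1 hv hE β hβ ε hε
  have hFc : ∀ s, Continuous (F s) := fun s =>
    tbn_continuous_kcw (hA.uncurry_left s) (hb.uncurry_left s) (hG.uncurry_left s)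
      (hu.uncurry_left s)
  -- Step 3: the SCALED functional `F' = C⁻¹ F` — same class (weights `C⁻¹A, C⁻¹b, G`), growth `1`, same orthogonality rows
  obtain ⟨F', hF'⟩ : ∃ F' : ℝ → T3 × V3 → ℝ, ∀ s y, F' s y = C⁻¹ * F s y := ⟨_, fun _ _ => rfl⟩
  have hF'fun : ∀ s, F' s = fun y => C⁻¹ * F s y := fun s => funext (hF' s)
  have hF'c : ∀ s, Continuous (F' s) := fun s => by
    rw [hF'fun s]
    exact continuous_const.mul (hFc s)
  have hF'rep : ∀ s (y : T3 × V3), F' s y =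
      (∑ j : Fin 3, ∑ k : Fin 3, (C⁻¹ * A s y.1 j k) * ((y.2 - u₀ s y.1) j * (y.2 - u₀ s y.1) k)) +
        (∑ j : Fin 3, (C⁻¹ • b s y.1) j * (y.2 - u₀ s y.1) j) * G s (y.1, ‖y.2 - u₀ s y.1‖ ^ 2) := by
    intro s y
    rw [hF']
    exact class_rep_smul (A s) (b s) (G s) (u₀ s) C⁻¹ y
  have hA' : Continuous (Function.uncurry fun (s : ℝ) (x : T3) (j k : Fin 3) => C⁻¹ * A s x j k) :=
    continuous_pi fun j => continuous_pi fun k =>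
      continuous_const.mul ((continuous_apply k).comp ((continuous_apply j).comp hA))
  have hb' : Continuous (Function.uncurry fun (s : ℝ) (x : T3) => C⁻¹ • b s x) := hb.const_smul C⁻¹
  have hCinv : 0 < C⁻¹ := inv_pos.2 hC0
  have hCb' : ∀ s ∈ Icc 0 t₁, ∀ y : T3 × V3, |F' s y| ≤ 1 * (1 + ‖y.2‖ ^ 2) := by
    intro s hs y
    rw [hF', abs_mul, abs_of_pos hCinv, one_mul]
    calc C⁻¹ * |F s y| ≤ C⁻¹ * (C * (1 + ‖y.2‖ ^ 2)) :=
          mul_le_mul_of_nonneg_left (hCb s hs y) hCinv.le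
      _ = 1 + ‖y.2‖ ^ 2 := by rw [← mul_assoc, inv_mul_cancel₀ hC0.ne', one_mul]
  have h1' : ∀ s ∈ Icc 0 t₁, ∀ x, ∫ v, F' s (x, v) * localMaxwellian 1 (θ₀ s x) (u₀ s x) v = 0 := by
    intro s hs x
    have hfun : (fun v => F' s (x, v) * localMaxwellian 1 (θ₀ s x) (u₀ s x) v) =
        fun v => C⁻¹ * (F s (x, v) * localMaxwellian 1 (θ₀ s x) (u₀ s x) v) := funext fun v => by
      rw [hF']; ring
    rw [hfun, integral_const_mul, h1 s hs x, mul_zero]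
  have hv' : ∀ s ∈ Icc 0 t₁, ∀ x (j : Fin 3),
      ∫ v, F' s (x, v) * v j * localMaxwellian 1 (θ₀ s x) (u₀ s x) v = 0 := by
    intro s hs x j
    have hfun : (fun v => F' s (x, v) * v j * localMaxwellian 1 (θ₀ s x) (u₀ s x) v) =
        fun v => C⁻¹ * (F s (x, v) * v j * localMaxwellian 1 (θ₀ s x) (u₀ s x) v) := funext fun v => by
      rw [hF']; ring
    rw [hfun, integral_const_mul, hv s hs x j, mul_zero]
  have hE' : ∀ s ∈ Icc 0 t₁, ∀ x,
      ∫ v, F' s (x, v) * ‖v‖ ^ 2 * localMaxwellian 1 (θ₀ s x) (u₀ s x) v = 0 := by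
    intro s hs x
    have hfun : (fun v => F' s (x, v) * ‖v‖ ^ 2 * localMaxwellian 1 (θ₀ s x) (u₀ s x) v) =
        fun v => C⁻¹ * (F s (x, v) * ‖v‖ ^ 2 * localMaxwellian 1 (θ₀ s x) (u₀ s x) v) :=
      funext fun v => by rw [hF']; ring
    rw [hfun, integral_const_mul, hE s hs x, mul_zero]
  -- the joint modulus of the scaled functional (S6 again; its bounds are discarded)
  obtain ⟨-, -, -, -, -, -, -, -, -, hmod⟩ :=
    hB t₁ a θ₀ u₀ ha hθ hu ha0 hθ0 _ _ G hA' hb' hG F' hF'rep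
  -- Step 4: the scaled tilt `βC`, `|βC| ≤ β₀`
  have hβC : |β * C| = |β| * C := by rw [abs_mul, abs_of_pos hC0]
  have hβ1 : |β * C| ≤ β₁ / 4 := hβC ▸ hβ.trans (min_le_left _ _)
  have hβ2 : |β * C| ≤ γ₀ / 48 := hβC ▸ hβ.trans (min_le_right _ _)
  have h4 : |4 * (β * C)| = 4 * |β * C| := by rw [abs_mul, abs_of_pos (by norm_num : (0 : ℝ) < 4)]
  have h4β : |4 * (β * C)| ≤ β₁ := by rw [h4]; linarith
  -- Step 5: the window tails at rate `γ = 24|βC|`, precision `ε/4`; this also fixes the tails' window threshold `τT`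
  obtain ⟨γ, hγ0, hγle, hγ4⟩ : ∃ γ : ℝ, 0 ≤ γ ∧ γ ≤ γ₀ ∧ |4 * (β * C)| * (6 * 1) ≤ γ := by
    refine ⟨24 * |β * C|, by positivity, by linarith, by rw [h4]; linarith⟩
  obtain ⟨V, hV1, τT, hτT, hT2⟩ := hT1 γ hγ0 hγle (ε / 4) (by positivity)
  -- Step 6: the joint modulus at radius `√(2V)` and the change of reference law, precision `ε/4`
  obtain ⟨ω, hω, hβω⟩ : ∃ ω : ℝ, 0 < ω ∧ |β * C| * ω ≤ ε / 4 := by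
    refine ⟨ε / 4 / (|β * C| + 1), by positivity, ?_⟩
    rw [show |β * C| * (ε / 4 / (|β * C| + 1)) = ε / 4 * (|β * C| / (|β * C| + 1)) by ring]
    exact mul_le_of_le_one_right (by positivity) ((div_le_one (by positivity)).2 (by linarith))
  obtain ⟨δ₁, hδ₁, hmod1⟩ := hmod (Real.sqrt (2 * V)) ω hω
  obtain ⟨δ₂, hδ₂, hlaw⟩ := hR t₁ a θ₀ u₀ ha hθ hu ha0 hθ0 σ hσ hσ2 (ε / 4) (by positivity)
  obtain ⟨δ, hδ, hδ1, hδ2⟩ : ∃ δ : ℝ, 0 < δ ∧ δ ≤ δ₁ ∧ δ ≤ δ₂ :=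
    ⟨min δ₁ δ₂, lt_min hδ₁ hδ₂, min_le_left _ _, min_le_right _ _⟩
  -- Step 7: the net `s_k = min t₁ (kδ)` and the pointwise rung (S1, growth `1`) at every node for `F'`, tilt `4βC`
  obtain ⟨sk, hsk, hsk_eq⟩ : ∃ sk : ℕ → ℝ, (∀ k, sk k ∈ Icc 0 t₁) ∧
      ∀ k : ℕ, (k : ℝ) * δ ≤ t₁ → sk k = k * δ :=
    ⟨fun k => min t₁ (k * δ), fun k => ⟨le_min ht (by positivity), min_le_left _ _⟩,
      fun k hk => min_eq_right hk⟩
  have hnet := fun k : ℕ =>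
    hK1 (a (sk k)) (θ₀ (sk k)) (u₀ (sk k)) (ha.uncurry_left _) (hθ.uncurry_left _)
      (hu.uncurry_left _) (hΛb _ (hsk k)) (hΘb _ (hsk k)) (hUb _ (hsk k)) (hguard1 _ (hsk k)) Φ
      (fun x j k' => C⁻¹ * A (sk k) x j k') (fun x => C⁻¹ • b (sk k) x) (G (sk k))
      (hA'.uncurry_left _) (hb'.uncurry_left _)
      (hG.uncurry_left _) (F' (sk k)) (fun y => hF'rep (sk k) y) (hCb' _ (hsk k)) (h1' _ (hsk k))
      (hv' _ (hsk k)) (hE' _ (hsk k)) (4 * (β * C)) h4β ε hε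
  obtain ⟨τ₀, hτ₀, hnet'⟩ := tbn_net_thresholds (Finset.range (⌈t₁ / δ⌉₊ + 1)) hnet
  refine ⟨τ₀ + τT, by positivity, fun τ hτ => ?_⟩
  have hτpos : 0 < τ := by linarith
  obtain ⟨N₁, hN₁⟩ := hnet' τ (by linarith [hτT.le])
  obtain ⟨NT, hNT⟩ := hT2 τ (by linarith [hτ₀.le])
  refine ⟨N₁ + NT, fun N hN s' hs' => ?_⟩
  -- Step 8: the nearest node to the left of `s'`
  obtain ⟨k, hkδ, hs'k, hk_mem⟩ : ∃ k : ℕ, (k : ℝ) * δ ≤ s' ∧ s' < k * δ + δ ∧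
      k ∈ Finset.range (⌈t₁ / δ⌉₊ + 1) := by
    refine ⟨⌊s' / δ⌋₊, ?_, ?_, ?_⟩
    · have h := Nat.floor_le (div_nonneg hs'.1 hδ.le)
      rwa [le_div_iff₀ hδ] at h
    · have h := Nat.lt_floor_add_one (s' / δ)
      rw [div_lt_iff₀ hδ] at h
      linarith
    · exact Finset.mem_range.2 (Nat.lt_add_one_iff.2 ((Nat.floor_le_ceil _).trans
        (Nat.ceil_le_ceil (div_le_div_of_nonneg_right hs'.2 hδ.le))))
  have hdist : |sk k - s'| ≤ δ := by
    rw [hsk_eq k (hkδ.trans hs'.2), abs_sub_comm, abs_of_nonneg (by linarith)]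
    linarith
  have hw : 0 < τ * ((N : ℝ) + 1) ^ (-(1 / 3 : ℝ)) :=
    mul_pos hτpos (Real.rpow_pos_of_pos (by positivity) _)
  have hPgood : (localGibbsLaw σ (a (sk k)) (u₀ (sk k)) (θ₀ (sk k)) N (Φ N)) (Φ N).goodᶜ = 0 :=
    localGibbsLaw_absolutelyContinuous σ _ _ _ N (Φ N) (Φ N).measure_compl_good
  -- the window functional is linear: the `(β, F)` exponent is the `(βC, F')` exponent
  have key : ∀ z, β * ∑ i : Fin (N + 1), (τ * ((N : ℝ) + 1) ^ (-(1 / 3 : ℝ)))⁻¹ *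
        ∫ r in (0 : ℝ)..(τ * ((N : ℝ) + 1) ^ (-(1 / 3 : ℝ))), F s' ((Φ N).flow r z i) =
      β * C * ∑ i : Fin (N + 1), (τ * ((N : ℝ) + 1) ^ (-(1 / 3 : ℝ)))⁻¹ *
        ∫ r in (0 : ℝ)..(τ * ((N : ℝ) + 1) ^ (-(1 / 3 : ℝ))), F' s' ((Φ N).flow r z i) := by
    intro z
    have hI : ∀ i : Fin (N + 1),
        ∫ r in (0 : ℝ)..(τ * ((N : ℝ) + 1) ^ (-(1 / 3 : ℝ))), F' s' ((Φ N).flow r z i) =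
          C⁻¹ * ∫ r in (0 : ℝ)..(τ * ((N : ℝ) + 1) ^ (-(1 / 3 : ℝ))), F s' ((Φ N).flow r z i) := by
      intro i
      rw [← intervalIntegral.integral_const_mul]
      exact intervalIntegral.integral_congr fun r _ => hF' s' _
    simp_rw [hI, mul_left_comm _ C⁻¹, ← Finset.mul_sum]
    rw [← mul_assoc (β * C), mul_assoc β, mul_inv_cancel₀ hC0.ne', mul_one]
  refine (lintegral_congr fun z => by rw [key z]).trans_le ?_
  -- pointwise `|F'_{s'} − F'_{s_k}| ≤ ω + 6·max 0 (‖v‖² − V)`; the window functional is measurable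
  have hdiff : ∀ y, |F' s' y - F' (sk k) y| ≤ ω + 6 * 1 * max 0 (‖y.2‖ ^ 2 - V) :=
    tbn_abs_sub_le_of_modulus zero_le_one hV1 hω.le (hCb' _ (hsk k)) (hCb' s' hs') fun x v hxv =>
      hmod1 s' hs' (sk k) (hsk k) (by rw [abs_sub_comm]; exact hdist.trans hδ1) x v hxv
  have hmeas : AEMeasurable (fun z => ENNReal.ofReal (Real.exp (β * C * ∑ i,
      (τ * ((N : ℝ) + 1) ^ (-(1 / 3 : ℝ)))⁻¹ * ∫ r in (0 : ℝ)..(τ * ((N : ℝ) + 1) ^ (-(1 / 3 : ℝ))),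
      F' s' ((Φ N).flow r z i)))) (liouville (Torus.geometry (Fin 3)) (N + 1) (hsDiameter σ N)) := by
    refine (Real.measurable_exp.comp_aemeasurable (AEMeasurable.const_mul
      (Finset.aemeasurable_fun_sum _ fun i _ => ?_) (β * C))).ennreal_ofReal
    exact ((Φ N).aemeasurable_intervalIntegral_comp_flow_torus
      ((hF'c s').measurable.comp (measurable_pi_apply i)) 0 _ (Φ N).measure_compl_good).const_mul _
  -- (a) change of reference law `λ_{s'} → λ_{s_k}` (S5); (b) split of the square; (c) S1 at the node, tilt `4βC`;
  -- (d) the difference via the tails; (e) `ε/4 + ε/4 + (4|βC|ω + ε/4)/4 ≤ ε`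
  have haa := hlaw Φ N (sk k) (hsk k) s' hs' (hdist.trans hδ2) _ hmeas
  have hbb := tbn_lintegral_sq_le_split (Φ N) hPgood (hF'c (sk k)) (hF'c s')
    (τ * ((N : ℝ) + 1) ^ (-(1 / 3 : ℝ))) (β * C)
  have hdd := (tbn_lintegral_exp_window_sub_le (Φ N) hPgood (hF'c (sk k)) (hF'c s') hdiff hw
    (4 * (β * C)) (c := 4 * |β * C| * ω * ((N : ℝ) + 1)) (γ := γ) (by rw [Nat.cast_add_one, h4])
    hγ4).trans (mul_le_mul' le_rfl (hNT N ((Nat.le_add_left NT N₁).trans hN) (sk k) (hsk k)))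
  exact tbn_chain_le haa hbb (hN₁ N ((Nat.le_add_right N₁ NT).trans hN) k hk_mem) hdd
    (by positivity) (by linarith)

/-- **KCWF-Q ⟸ `KCWUSharpPlus` alone.** The class-uniform kinetic-currents window LD along families
(`HydroLimitInBandSignedBand.KineticCurrentsLDAlongFamiliesQ`, the registered stub `stub_kcwfQ` of the lines of stmt-17372 and
stmt-9133) follows from the single registered stub of crux 16659's line `Sketch` — the pointwise kinetic-window LD rung with a
numeric tilt threshold `β₀(Θ,U,C,Λ,σ)` for the class `A(x):w⊗w + (b(x)·w)G(x,|w|²) + K(x,|w|²)` (hypothesis byte-identical with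
`Cruxes/KineticCurrentsLDAlongFamilies/Lines/Sketch.lean: stub_kcwuSharpPlus` and with the hypothesis of the landed
`stub_kcwuSharpPlus_implies_crux`, p137412) — everything else being landed statics of that line: the family window tails from
the radial sector of the rung (p137070 ∘ p136745 ∘ p136419), the static change of reference law (p129139) and the family modulus
(p128108), assembled by `kcwfQ_transferByNetsEv` (net transfer at growth `1` after the scaling `F ↦ F/C`). [folklore] -/
theorem kcwfQ_of_kcwuSharpPlus :
    (∃ η₀ : ℝ, 0 < η₀ ∧ ∀ (Θ U C Λ : ℝ), 1 ≤ Θ → 0 ≤ U → 0 ≤ C → 1 ≤ Λ → ∀ σ : ℝ, 0 < σ →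
        ∃ β₀ : ℝ, 0 < β₀ ∧
        ∀ (a θ₀ : T3 → ℝ) (u₀ : T3 → V3), Continuous a → Continuous θ₀ → Continuous u₀ →
        (∀ x, Λ⁻¹ ≤ a x ∧ a x ≤ Λ) → (∀ x, Θ⁻¹ ≤ θ₀ x ∧ θ₀ x ≤ Θ) → (∀ x, ‖u₀ x‖ ≤ U) →
        σ ^ 3 * (⨆ x, a x) ≤ η₀ * ∫ x, a x →
        ∀ Φ : (N : ℕ) →
          HardSphereFlow (Torus.geometry (Fin 3)) (hsDiameter σ N) (N + 1),
        ∀ (A : T3 → Fin 3 → Fin 3 → ℝ) (b : T3 → V3) (G K : T3 × ℝ → ℝ),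
        Continuous A → Continuous b → Continuous G → Continuous K →
        ∀ F : T3 × V3 → ℝ, (∀ y, F y =
          (∑ j : Fin 3, ∑ k : Fin 3, A y.1 j k * ((y.2 - u₀ y.1) j * (y.2 - u₀ y.1) k)) +
            (∑ j : Fin 3, b y.1 j * (y.2 - u₀ y.1) j) * G (y.1, ‖y.2 - u₀ y.1‖ ^ 2) +
            K (y.1, ‖y.2 - u₀ y.1‖ ^ 2)) →
        (∀ y, |F y| ≤ C * (1 + ‖y.2‖ ^ 2)) →
        (∀ x, ∫ v, F (x, v) * localMaxwellian 1 (θ₀ x) (u₀ x) v = 0) →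
        (∀ x (j : Fin 3), ∫ v, F (x, v) * v j * localMaxwellian 1 (θ₀ x) (u₀ x) v = 0) →
        (∀ x, ∫ v, F (x, v) * ‖v‖ ^ 2 * localMaxwellian 1 (θ₀ x) (u₀ x) v = 0) →
        ∀ β : ℝ, |β| ≤ β₀ → ∀ ε : ℝ, 0 < ε → ∃ τ₀ : ℝ, 0 < τ₀ ∧ ∀ τ : ℝ, τ₀ ≤ τ →
        ∃ N₀ : ℕ, ∀ N : ℕ, N₀ ≤ N →
          ∫⁻ z, ENNReal.ofReal (Real.exp (β * ∑ i : Fin (N + 1),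
              (τ * ((N : ℝ) + 1) ^ (-(1 / 3 : ℝ)))⁻¹ *
                ∫ r in (0 : ℝ)..(τ * ((N : ℝ) + 1) ^ (-(1 / 3 : ℝ))), F (((Φ N).flow r z) i)))
            ∂(localGibbsLaw σ a u₀ θ₀ N (Φ N)) ≤
          ENNReal.ofReal (Real.exp (ε * ((N : ℝ) + 1)))) →
    HydroLimitInBandSignedBand.KineticCurrentsLDAlongFamiliesQ := fun h =>
  kcwfQ_transferByNetsEv (kcwuSharp_of_kcwuSharpPlus h)
    (stub_windowTailsFamily_of_pointwise (stub_radialTailsAt (kcwuSharpRadial_of_kcwuSharpPlus h)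
      stub_radialTailDominator) stub_lawChangeFamily stub_familyModulus)
    stub_lawChangeFamily stub_familyModulus

/-- **The route item stmt-18052 and the Theorems def are one proposition** (`OneFlightGossipEngine.KineticCurrentsLDAlongFamiliesQ`
was filed as the byte-copy of `HydroLimitInBandSignedBand.KineticCurrentsLDAlongFamiliesQ`). [folklore] -/
theorem kcwfQ_iff_routeItem :
    Theses.OneFlightGossipEngine.KineticCurrentsLDAlongFamiliesQ ↔
      HydroLimitInBandSignedBand.KineticCurrentsLDAlongFamiliesQ :=
  Iff.rfl

/-- **KCWF (stmt-16659) from the route item KCWF-Q (stmt-18052)** — the landed `kcwf_of_kcwfQ` read through `kcwfQ_iff_routeItem`: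
the item 16659 is a corollary of the item 18052. [folklore] -/
theorem kcwf_of_routeKcwfQ (h : Theses.OneFlightGossipEngine.KineticCurrentsLDAlongFamiliesQ) :
    KineticCurrentsLDAlongFamilies := by
  have h' : HydroLimitInBandOfHeart.KineticCurrentsWindowLDFamily := kcwf_of_kcwfQ (kcwfQ_iff_routeItem.1 h)
  exact h'

end Summit.AtomisticToContinuum.HydrodynamicLimit.Theorems.HydroLimitProfilewiseBandKcwfQ

end
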